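import Literature.Claims.NS.ClayVariants
import Literature.Analysis.FluidPDE.ClassicalSolution
import HarnessLib

/-!
# Claim skeleton (D-0090 NS-CLAIMS, C95; T3 QUICK tranche tail): Alpay 2025 — «Global Smoothness
# and Existence for the Navier–Stokes Equations in Clay-ξ↔ Format» (energy inequality ⇒ bounded
# L² norm ⇒ «Sobolev embedding, bootstrapping» ⇒ no blow-up)

Typed skeleton of Faruk Alpay, *Global Smoothness and Existence for the Navier–Stokes Equations in
Clay-ξ↔ Format*, Zenodo record 15355388 (2025-05-07; = Authorea doi:10.22541/au.174664105.54119607/v1),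
4 pp. (PDF page = printed page) = bib `Alpay2025`, text of record of cell `ns-claims` row C95 (sources
`run/shared/lean/pub/ns-claims/sources/Alpay2025/`, LOCATORS by ns-claims-lit-1 g6). UNREFEREED CLAIM under
adjudication — NOTHING in this file asserts a step of the paper: the paper's statements are `def … : Prop`;
the `theorem`s are the kernel composition of the paper's own chain, the one elementary step that holds
by unfolding (`step_ii_holds`), and the Clay-delta plumbing. QUICK grain (cell RULINGS v1.29l (4)).

## The claimed statement, as printed (Theorem 1, p.2)
«Assume that the Navier–Stokes equations (1), (2) satisfy the energy inequality (3) for all t ≥ 0. Then: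
1. There exists a constant M > 0 such that ‖χ(t)‖ ≤ M for all t ≥ 0. 2. The solution χ(t) is global in
time and smooth: χ(t) ∈ C^∞(Ω × [0,∞)), and this global smoothness implies compliance with ϕ∞(χ0) ∈ Ξ∞
in the sense of the Clay-ξ↔ criteria.» with (1) `∂ₜχ + (χ·∇)χ = −∇p + νΔχ, ∇·χ = 0`, (2) `χ(0) = χ₀`
(the printed boundary clause «Δ₀ ∈ ∂Ω» is garbled; «Ω ⊂ ℝ³» is not specified further), (3)
`d/dt E(t) ≤ −C‖∇χ(t)‖², E(t) = ‖χ(t)‖²` (§2 p.2); abstract p.1: «My conclusions confirm compliance with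
the Clay Millennium Problem criteria». The «Clay-ξ↔ / ϕ∞(χ0) ∈ Ξ∞» decoration is undefined in print and
is not typed.
TYPED (`ClaimedTheorem`, on `ℝ³`, data of Clay class (4)): for every `ν > 0`, IF every finite-energy
classical solution issued from a Clay datum obeys the energy inequality (3) — typed in the integrated
form the proof uses («Integrating over [0, t] yields …»): the energy `E(t) = ∫|χ(t)|²` is non-increasing —
THEN Clay (A) holds at `ν` (`clayR3.RegularityAt ν`: every Clay datum has a global smooth finite-energy
solution).

## Delta to Clay (`ClayVariants` §3) — `ClayDelta`
Nearest: (A). Δ1 «Ω ⊂ ℝ³» unspecified → typed on `ℝ³` · Δ2 = · Δ3 f ≡ 0 = · Δ4 no data class named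
→ typed with (4) · Δ5 C^∞ + `‖χ‖ ≤ M` → (6) ∧ (7) via `clayR3.Solvable` · **Δ6 CONDITIONAL on (3)** · Δ7
ν > 0. `ClayDelta := ∀ ν > 0, Hyp3 ν` — the energy inequality for finite-energy classical solutions
(classical: Leray's energy equality/inequality), the hypothesis of Theorem 1; with it,
`clay_of_claimed_of_delta : ClayDelta → ClaimedTheorem → clayR3.Regularity`.

## Ordered Step index (print order §4 p.3; `claim_of_steps` consumes Steps (ii), (iii))
* Step (i) = local existence («By standard arguments (e.g. Galerkin approximation …) one obtains a local
  solution χ(t) for t ∈ [0, T_loc]») — classical; folded into Step (iii)'s conclusion (existence).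
* Step (ii) = `Step_ii` — «Energy Bound … Integrating over [0, t] yields a uniform bound on E(t) …
  ‖χ(t)‖² ≤ ‖χ₀‖² − ∫₀ᵗ C‖∇χ(s)‖² ds. Hence ‖χ(t)‖ ≤ M»: (3) ⇒ `E(t) ≤ E(0)` along every finite-energy
  classical solution. PROVED by unfolding (`step_ii_holds`).
* Step (iii) = `Step_iii` — «Global Regularity. Once I have a uniform bound on ‖χ(t)‖, classical PDE
  methods (Sobolev embedding, bootstrapping arguments) show that ∇χ(t) also remains in a controllable
  norm. Iterating these estimates indicates that χ(t) retains smoothness and cannot blow up. Thus the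
  solution extends for all t ≥ 0 in a C^∞ manner»: the uniform L² bound yields, for every Clay datum, a
  global smooth finite-energy solution. LOAD-BEARING.
COMPOSITION: `claim_of_steps : Step_ii → Step_iii → ClaimedTheorem` (PROVED).

## References
* F. Alpay, Zenodo 15355388 (`Alpay2025`): abstract p.1; §2 (1)–(3) p.2; Theorem 1 p.2; §4 (i)–(iii)
  p.3; §5 p.3.
* Cell files: `claims/Alpay2025/CARD.md` (typist-1 g2; PREDICTION 2026-08-27T02:25:04Z, informed),
  `sources/Alpay2025/LOCATORS.md` (lit-1 g6).

WHAT THIS IS NOT: not a claim about NS regularity or blow-up; not a claim about any author beyond the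
typed locator.
-/

noncomputable section

open Set MeasureTheory
open scoped ContDiff ENNReal

namespace Literature.Claims.NS.Alpay2025

open Literature.Analysis.FluidPDE Literature.Claims.NS.ClayVariants

/-- Physical space `ℝ³`. [folklore] -/
abbrev R3 : Type := EuclideanSpace ℝ (Fin 3)

/-- The energy `E(t) = ‖χ(t)‖² = ∫ |χ(t,x)|² dx` (§2 p.2), as an extended non-negative real.
[cite: Alpay2025, §2 p.2] -/
def energy (u : ℝ → R3 → R3) (t : ℝ) : ℝ≥0∞ := ∫⁻ x, ‖u t x‖ₑ ^ 2

/-- A finite-energy classical solution of (1)–(2) on `ℝ³ × [0,T)` from the datum `u₀` (the object the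
print calls «the solution χ(t)», with `E(t) < ∞` so that (3) is meaningful). [cite: Alpay2025, §2 (1)–(2) p.2] -/
def IsFiniteEnergySolution (ν : ℝ) (u₀ : R3 → R3) (T : ℝ) (u : ℝ → R3 → R3) (p : ℝ → R3 → ℝ) : Prop :=
  IsClassicalNSSolutionOn (Ico 0 T) ν 0 u p ∧ u 0 = u₀ ∧ ∀ t ∈ Ico 0 T, energy u t < ⊤

/-- **Hypothesis (3) of Theorem 1** («the Navier–Stokes equations (1), (2) satisfy the energy inequality
(3) for all t ≥ 0», `d/dt E(t) ≤ −C‖∇χ(t)‖², C > 0), typed in the integrated form the proof uses (§4 (ii)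
«Integrating over [0, t] …»): along every finite-energy classical solution from a Clay datum the energy is
non-increasing. [claim: Alpay2025, status: under-review] [cite: Alpay2025, §2 eq. (3) p.2; Theorem 1 hypothesis p.2; §4 (ii) p.3] -/
def Hyp3 (ν : ℝ) : Prop :=
  ∀ u₀ : R3 → R3, ContDiff ℝ ∞ u₀ → NSWave0.IsDivFree u₀ → HasRapidSpatialDecay u₀ →
    ∀ T : ℝ, 0 < T → ∀ (u : ℝ → R3 → R3) (p : ℝ → R3 → ℝ), IsFiniteEnergySolution ν u₀ T u p →
      ∀ s t : ℝ, 0 ≤ s → s ≤ t → t < T → energy u t ≤ energy u s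

/-- **Theorem 1 item 1 / §4 (ii)** («There exists a constant M > 0 such that ‖χ(t)‖ ≤ M for all t ≥ 0»;
«‖χ(t)‖² ≤ ‖χ₀‖² − ∫₀ᵗ C‖∇χ(s)‖² ds. Hence ‖χ(t)‖ ≤ M»): the uniform `L²` bound `E(t) ≤ E(0)` along
every finite-energy classical solution from a Clay datum. [claim: Alpay2025, status: under-review] [cite: Alpay2025, Theorem 1 item 1 p.2; §4 (ii) p.3] -/
def L2Bound (ν : ℝ) : Prop :=
  ∀ u₀ : R3 → R3, ContDiff ℝ ∞ u₀ → NSWave0.IsDivFree u₀ → HasRapidSpatialDecay u₀ →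
    ∀ T : ℝ, 0 < T → ∀ (u : ℝ → R3 → R3) (p : ℝ → R3 → ℝ), IsFiniteEnergySolution ν u₀ T u p →
      ∀ t ∈ Ico 0 T, energy u t ≤ energy u 0

/-! ## The claimed statement -/

/-- **CLAIMED THEOREM (Theorem 1 p.2, item 2, read on `ℝ³` with Clay data)**: for every `ν > 0`, if the
energy inequality (3) holds for the finite-energy classical solutions, then every Clay datum has a global
smooth finite-energy solution of (1)–(2) («The solution χ(t) is global in time and smooth: χ(t) ∈
C^∞(Ω × [0,∞)) … compliance with the Clay Millennium Problem criteria»). [claim: Alpay2025, status: under-review] [cite: Alpay2025, Theorem 1 p.2; abstract p.1; §5 p.3] -/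
def ClaimedTheorem : Prop :=
  ∀ ν : ℝ, 0 < ν → Hyp3 ν → clayR3.RegularityAt ν

/-! ## The Steps -/

/-- **Step (ii) — §4 (ii) p.3 «Energy Bound»**: (3) ⇒ the uniform `L²` bound. [claim: Alpay2025, status: under-review] [cite: Alpay2025, §4 (ii) p.3] -/
def Step_ii : Prop :=
  ∀ ν : ℝ, 0 < ν → Hyp3 ν → L2Bound ν

/-- **Step (iii) — §4 (iii) p.3 «Global Regularity» (with (i) «Local Existence»)**: «Once I have a uniform
bound on ‖χ(t)‖, classical PDE methods (Sobolev embedding, bootstrapping arguments) show that ∇χ(t) also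
remains in a controllable norm. Iterating these estimates indicates that χ(t) retains smoothness and
cannot blow up. Thus the solution extends for all t ≥ 0 in a C^∞ manner, proving global existence and
smoothness» — the uniform `L²` bound yields Clay-sense global solvability for every Clay datum.
LOAD-BEARING. [claim: Alpay2025, status: under-review] [cite: Alpay2025, §4 (i), (iii) p.3] -/
def Step_iii : Prop :=
  ∀ ν : ℝ, 0 < ν → L2Bound ν → clayR3.RegularityAt ν

/-! ## Kernel composition and plumbing -/

/-- **Step (ii) holds by unfolding**: non-increase of the energy gives `E(t) ≤ E(0)` (take `s = 0`).
[cite: Alpay2025, §4 (ii) p.3] -/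
theorem step_ii_holds : Step_ii := by
  intro ν _ h u₀ hs hdiv hdec T hT u p hsol t ht
  exact h u₀ hs hdiv hdec T hT u p hsol 0 t le_rfl ht.1 ht.2

/-- **COMPOSITION** (§4: (ii) then (iii)). [cite: Alpay2025, §4 p.3; §5 p.3] -/
theorem claim_of_steps (h₂ : Step_ii) (h₃ : Step_iii) : ClaimedTheorem :=
  fun ν hν h3 => h₃ ν hν (h₂ ν hν h3)

/-- The claimed theorem therefore reduces to Step (iii) alone. [cite: Alpay2025, §4 p.3] -/
theorem claim_of_step_iii (h₃ : Step_iii) : ClaimedTheorem :=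
  claim_of_steps step_ii_holds h₃

/-- **`ClayDelta` — the hypothesis of Theorem 1**: the energy inequality (3) at every viscosity (Δ6: the
printed theorem is CONDITIONAL on (3); for finite-energy classical solutions (3) is Leray's classical
energy inequality — recorded here as the hypothesis the identification with (A) needs, not asserted).
[claim: Alpay2025, status: under-review] [cite: Alpay2025, §2 eq. (3) p.2; Theorem 1 p.2] -/
def ClayDelta : Prop :=
  ∀ ν : ℝ, 0 < ν → Hyp3 ν

/-- `ClayDelta → ClaimedTheorem → clayR3.Regularity` (cell schema). [cite: Alpay2025, Theorem 1 p.2; abstract p.1] -/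
theorem clay_of_claimed_of_delta (hΔ : ClayDelta) (hC : ClaimedTheorem) : clayR3.Regularity :=
  fun ν hν => hC ν hν (hΔ ν hν)

/-! ## ROUTE-5b kernel record (rev 2, cell `ns-claims` typist-3 g3 kit for the C95 refuter / referee)

The load-bearing Step (iii) consumes the uniform `L²` bound `L2Bound ν` and returns Clay-sense global
solvability. The records below identify the step with Clay (A) itself MODULO that bound (Theorem 1
item 1, which the print takes from its hypothesis (3) — `step_ii_holds`): in both directions, and already
from a single viscosity (`clayR3_regularityAt_iff`: (A) at one `ν` is (A)). Nothing here asserts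
`L2Bound`, `Hyp3` or `Step_iii`; every statement is an implication / `Iff` under displayed hypotheses.
This is the «global ⇒ global» identification named in `claims/Alpay2025/RETYPE.md` §2–§3 (ref-1 g2):
with Leray's `L²` bound in hand the one printed sentence §4 (iii) p.3 l.24–28 is (A) at `ν`. -/

/-- (A) implies Step (iii) outright (the `L²`-bound hypothesis is not needed in this direction).
[cite: Alpay2025, §4 (iii) p.3] -/
theorem step_iii_of_clay (h : clayR3.Regularity) : Step_iii :=
  fun ν hν _ => h ν hν

/-- Step (iii) together with the uniform `L²` bound at every viscosity (Theorem 1 item 1) IS Clay (A).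
[cite: Alpay2025, Theorem 1 item 1 p.2; §4 (iii) p.3] -/
theorem clay_of_step_iii (hL : ∀ ν : ℝ, 0 < ν → L2Bound ν) (h : Step_iii) : clayR3.Regularity :=
  fun ν hν => h ν hν (hL ν hν)

/-- **ROUTE-5b identification**: modulo the uniform `L²` bound (Theorem 1 item 1 at every `ν > 0`),
Step (iii) — «Once I have a uniform bound on ‖χ(t)‖, classical PDE methods (Sobolev embedding,
bootstrapping arguments) show that ∇χ(t) also remains in a controllable norm … extends for all t ≥ 0 in
a C^∞ manner» — is EQUIVALENT to Clay (A) (`clayR3.Regularity`, token-for-token the summit statement).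
[cite: Alpay2025, §4 (iii) p.3 l.24–28; Theorem 1 p.2] -/
theorem step_iii_iff_clay_of_L2Bound (hL : ∀ ν : ℝ, 0 < ν → L2Bound ν) :
    Step_iii ↔ clayR3.Regularity :=
  ⟨clay_of_step_iii hL, step_iii_of_clay⟩

/-- **One viscosity suffices**: Step (iii), fed the `L²` bound at a single `ν > 0`, already yields Clay
(A) at every viscosity ((A) at one `ν` ⇔ (A), `clayR3_regularityAt_iff`).
[cite: Alpay2025, §4 (iii) p.3; Theorem 1 p.2] -/
theorem clay_of_step_iii_at (h : Step_iii) {ν : ℝ} (hν : 0 < ν) (hL : L2Bound ν) :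
    clayR3.Regularity :=
  (clayR3_regularityAt_iff hν).1 (h ν hν hL)

/-- Under hypothesis (3) at a single `ν > 0` (so that the `L²` bound holds there by `step_ii_holds`),
Step (iii) is again equivalent to Clay (A). [cite: Alpay2025, §2 eq. (3) p.2; §4 (ii)–(iii) p.3] -/
theorem step_iii_iff_clay_of_hyp3_at {ν : ℝ} (hν : 0 < ν) (h3 : Hyp3 ν) :
    Step_iii ↔ clayR3.Regularity :=
  ⟨fun h => clay_of_step_iii_at h hν (step_ii_holds ν hν h3), step_iii_of_clay⟩

/-- (A) implies the claimed theorem outright. [cite: Alpay2025, Theorem 1 p.2] -/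
theorem claimed_of_clay (h : clayR3.Regularity) : ClaimedTheorem :=
  fun ν hν _ => h ν hν

/-- Under its own hypothesis (3) (`ClayDelta`), the claimed Theorem 1 is EQUIVALENT to Clay (A).
[cite: Alpay2025, Theorem 1 p.2; abstract p.1] -/
theorem claimedTheorem_iff_clay_of_delta (hΔ : ClayDelta) : ClaimedTheorem ↔ clayR3.Regularity :=
  ⟨clay_of_claimed_of_delta hΔ, claimed_of_clay⟩

/-- Under hypothesis (3) at a single `ν > 0`, the claimed Theorem 1 is equivalent to Clay (A).
[cite: Alpay2025, Theorem 1 p.2] -/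
theorem claimedTheorem_iff_clay_of_hyp3_at {ν : ℝ} (hν : 0 < ν) (h3 : Hyp3 ν) :
    ClaimedTheorem ↔ clayR3.Regularity :=
  ⟨fun hC => (clayR3_regularityAt_iff hν).1 (hC ν hν h3), claimed_of_clay⟩

/-- Under hypothesis (3) (`ClayDelta`) the chain's only substantive step and its conclusion coincide:
Step (iii) ⇔ the claimed Theorem 1 (both ⇔ (A)). [cite: Alpay2025, §4 p.3; Theorem 1 p.2] -/
theorem step_iii_iff_claimed_of_delta (hΔ : ClayDelta) : Step_iii ↔ ClaimedTheorem :=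
  (step_iii_iff_clay_of_L2Bound fun ν hν => step_ii_holds ν hν (hΔ ν hν)).trans
    (claimedTheorem_iff_clay_of_delta hΔ).symm

end Literature.Claims.NS.Alpay2025

end

-- WHAT THIS IS NOT: not a claim about NS regularity or blow-up; not a claim about any author beyond the
-- typed locator.
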